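import Summits.Ventures.HodgeRepro2.T5TameCongruence
import Summits.Ventures.HodgeRepro2.T5SexticDecomposition

/-!
# T5DecompositionOrder — «c ∈ D_p iff |D_p| is even», and |D_p| = e · f

Seat p3 of the blind cell `pub-hodge-repro2` (Tier-5 support column for sub-step N2 of
`route/TIER5.md`).  A kernel witness behind the middle links of row N2.2.5 of
`route/T5-N2-route-3.md`: «… iff `c ∈ D_p` iff `Frob_p` has even order iff …», read with
`D_p` = the decomposition group = stabiliser of a prime `P` above `p` in `Gal(E/ℚ)`, and
«`Frob_p` has even order» as «`|D_p|` is even» (`D_p = ⟨Frob_p⟩` for unramified `p`, so the two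
agree; the Frobenius element itself stays prose).

* `card_stabilizer_eq_ramificationIdx_mul_inertiaDeg`: for a Galois number field `F/ℚ`,
  `|D_P| = e(P ∣ p) · f(P ∣ p)` — orbit–stabiliser (`MulAction.index_stabilizer`) with the orbit
  of `P` equal to the set of primes above `p` (`Algebra.IsInvariant.orbit_eq_primesOver`) and the
  fundamental identity `g · e · f = [F : ℚ]` of `T5TameCongruence`.
* `mem_iff_two_dvd_card`: in a finite cyclic group, an element `c` of order `2` lies in a subgroup
  `H` if and only if `|H|` is even (Lagrange; conversely Cauchy gives an element of order `2` in
  `H`, and a cyclic group has at most one — `IsCyclic.card_pow_eq_one_le`).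
* For the sextic field `E` with `Gal(E/ℚ)` cyclic and `c` of order `2` (the complex conjugation):
  `c ∈ D_P ⟺ 2 ∣ e · f`; for `p` unramified `⟺ 2 ∣ f(P ∣ p) ⟺ f(𝔮 ∣ p) = 2` for the prime
  `𝔮 = P ∩ 𝓞 K` of the quadratic subfield (`T5SexticDecomposition`).

Declaration of README §8(d): this file uses an L-value-free non-vanishing device: NO.
-/

namespace Summit.Ventures.HodgeRepro2.T5DecompositionOrder

open NumberField Ideal
open scoped Pointwise

section stabilizer

variable {F : Type*} [Field F] [NumberField F] [IsGalois ℚ F]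

/-- **The order of the decomposition group is `e · f`.**  For a Galois number field `F/ℚ` and a
prime `P` of `𝓞 F` above a rational prime `p`, the stabiliser of `P` in `Gal(F/ℚ)` has
`e(P ∣ p) · f(P ∣ p)` elements. -/
theorem card_stabilizer_eq_ramificationIdx_mul_inertiaDeg {p : ℕ} (hp : p.Prime)
    (P : Ideal (𝓞 F)) [P.IsPrime] [P.LiesOver (span {(p : ℤ)})] :
    Nat.card (MulAction.stabilizer Gal(F/ℚ) P) = P.ramificationIdx ℤ * P.inertiaDeg ℤ := by
  haveI := T5TameCongruence.isGaloisGroup_gal (F := F)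
  have hidx : (MulAction.stabilizer Gal(F/ℚ) P).index =
      ((span {(p : ℤ)}).primesOver (𝓞 F)).ncard := by
    rw [MulAction.index_stabilizer,
      Algebra.IsInvariant.orbit_eq_primesOver ℤ (𝓞 F) Gal(F/ℚ) (span {(p : ℤ)}) P]
  have h1 := (MulAction.stabilizer Gal(F/ℚ) P).index_mul_card
  rw [hidx, IsGalois.card_aut_eq_finrank,
    ← T5TameCongruence.ncard_primesOver_mul_ramificationIdx_mul_inertiaDeg hp P] at h1
  have hg : ((span {(p : ℤ)}).primesOver (𝓞 F)).ncard ≠ 0 := by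
    intro h
    have := T5TameCongruence.ncard_primesOver_mul_ramificationIdx_mul_inertiaDeg hp P
    rw [h, zero_mul] at this
    exact (Module.finrank_pos (R := ℚ) (M := F)).ne' this.symm
  exact Nat.eq_of_mul_eq_mul_left (Nat.pos_of_ne_zero hg) h1

end stabilizer

section cyclic

variable {G : Type*} [Group G] [Finite G] [IsCyclic G]

/-- In a finite cyclic group an element of order `2` is unique. -/
theorem eq_of_orderOf_eq_two {c x : G} (hc : orderOf c = 2) (hx : orderOf x = 2) : x = c := by
  classical
  haveI := Fintype.ofFinite G
  have hle := IsCyclic.card_pow_eq_one_le (α := G) (n := 2) (by norm_num)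
  have h1 : (1 : G) ∈ ({a : G | a ^ 2 = 1} : Finset G) := by simp
  have hc' : c ∈ ({a : G | a ^ 2 = 1} : Finset G) := by simp [← hc, pow_orderOf_eq_one]
  have hx' : x ∈ ({a : G | a ^ 2 = 1} : Finset G) := by simp [← hx, pow_orderOf_eq_one]
  have hc1 : c ≠ 1 := by
    intro h; rw [h, orderOf_one] at hc; exact absurd hc (by norm_num)
  have hx1 : x ≠ 1 := by
    intro h; rw [h, orderOf_one] at hx; exact absurd hx (by norm_num)
  by_contra hxc
  have : 2 < ({a : G | a ^ 2 = 1} : Finset G).card :=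
    Finset.two_lt_card.mpr ⟨1, h1, c, hc', x, hx', hc1.symm, hx1.symm, fun h => hxc h.symm⟩
  omega

/-- **Membership of the involution in a subgroup is a parity condition.**  In a finite cyclic
group, an element `c` of order `2` lies in a subgroup `H` if and only if `|H|` is even. -/
theorem mem_iff_two_dvd_card {c : G} (hc : orderOf c = 2) (H : Subgroup G) :
    c ∈ H ↔ 2 ∣ Nat.card H := by
  constructor
  · intro h
    rw [← hc]
    exact H.orderOf_dvd_natCard h
  · intro h
    classical
    haveI := Fintype.ofFinite H
    haveI : Fact (Nat.Prime 2) := ⟨Nat.prime_two⟩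
    rw [Nat.card_eq_fintype_card] at h
    obtain ⟨x, hx⟩ := exists_prime_orderOf_dvd_card 2 h
    have hx' : orderOf (x : G) = 2 := by rw [Subgroup.orderOf_coe, hx]
    rw [← eq_of_orderOf_eq_two hc hx']
    exact x.2

end cyclic

section sextic

variable {E : Type*} [Field E] [NumberField E] [IsGalois ℚ E] [IsCyclic Gal(E/ℚ)]
  {c : Gal(E/ℚ)} (hc : orderOf c = 2)
  {p : ℕ} (hp : p.Prime) (P : Ideal (𝓞 E)) [P.IsPrime] [P.LiesOver (span {(p : ℤ)})]

include hc hp in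
/-- **«c ∈ D_P iff |D_P| is even».**  For a cyclic Galois number field `E/ℚ` with involution `c`
(the complex conjugation of the sextic CM field) and a prime `P` above `p`: `c` lies in the
decomposition group of `P` if and only if `e(P ∣ p) · f(P ∣ p)` is even. -/
theorem conj_mem_stabilizer_iff :
    c ∈ MulAction.stabilizer Gal(E/ℚ) P ↔ 2 ∣ P.ramificationIdx ℤ * P.inertiaDeg ℤ := by
  rw [mem_iff_two_dvd_card hc, card_stabilizer_eq_ramificationIdx_mul_inertiaDeg hp P]

include hc hp in
/-- For `p` unramified in `E`: `c ∈ D_P` if and only if the inertia degree `f(P ∣ p)` is even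
(«`Frob_p` has even order», `D_P = ⟨Frob_p⟩` being of order `f`). -/
theorem conj_mem_stabilizer_iff_of_unramified (he : P.ramificationIdx ℤ = 1) :
    c ∈ MulAction.stabilizer Gal(E/ℚ) P ↔ 2 ∣ P.inertiaDeg ℤ := by
  rw [conj_mem_stabilizer_iff hc hp P, he, one_mul]

variable {K : Type*} [Field K] [NumberField K] [Algebra K E] [IsGalois K E] [IsGalois ℚ K]

include hc hp in
/-- **«c ∈ D_p iff p does not split in K»** (row N2.2.5, for `p` unramified in `E`, through the
inertia degrees): `c ∈ D_P` if and only if `f(𝔮 ∣ p) = 2` for the prime `𝔮 = P ∩ 𝓞 K` of the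
quadratic subfield. -/
theorem conj_mem_stabilizer_iff_inertiaDeg_quadratic (hKE : Module.finrank K E = 3)
    (hK : Module.finrank ℚ K = 2) (he : P.ramificationIdx ℤ = 1) :
    c ∈ MulAction.stabilizer Gal(E/ℚ) P ↔ (P.under (𝓞 K)).inertiaDeg ℤ = 2 := by
  rw [conj_mem_stabilizer_iff_of_unramified hc hp P he]
  exact T5SexticDecomposition.two_dvd_inertiaDeg_iff_quadratic hKE hK hp P

end sextic

end Summit.Ventures.HodgeRepro2.T5DecompositionOrder
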